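import Literature.NumberTheory.EllipticCurves.RootNumberLocalConstancyProofs
import Literature.NumberTheory.EllipticCurves.RootNumberSmulProofs
import HarnessLib

/-!
# Helfgott's locally constant local tables: reduction to the residual input above `2` and `3`

A second `…Proofs` sibling (theorems only: no definition, no named fact, no instance) of
`Literature.NumberTheory.EllipticCurves.RootNumberLocalConstancy`, written by the `provefact` seat of
the named fact
`Literature.NumberTheory.EllipticCurves.Helfgott2004_exists_local_tables_locallyConstant` (Helfgott
2004, §4: the local root numbers `W(E/ℚ_v)`, as functions of `v`-integral Weierstrass coefficients,
are locally constant; vendored as local tables `w_v` at all finite places of `ℚ` with clauses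
(1) `±1`-valued, (2) `ℚ_v`-invariant, (3) Rohrlich's `localRootNumber` above `p ≥ 5`, (4) the product
formula for the analytic global root number, (5) local constancy).

The sibling `RootNumberLocalConstancyProofs` proved clause (5) at every place `v ∤ 6` (Helfgott's
argument in residue characteristic `≥ 5`, for Rohrlich's case list) and reduced the named fact to
local tables with clauses (1)–(4) that are locally constant above `2` and `3`
(`Helfgott2004_exists_local_tables_locallyConstant_iff_two_three`). This file reduces what is left
to its genuinely residual input, in the manner of `exists_local_tables_two_three_of_residual`
(file `BSDRootNumberLocalTablesProofs`) for the weaker named fact `exists_local_tables_two_three`: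

* `Helfgott2004_exists_local_tables_locallyConstant_of_residual` — the named fact follows from
  1. the Modularity Theorem `exists_isNewformOf` (BCDT 2001, Thm. A);
  2. Kellock–Dokchitser 2023, Rem. 2.2 at the primes `p ≥ 5` against Rohrlich's list (the named
     fact `WeierstrassCurve.atkinLehnerEigenvalueAt_eq_localRootNumberAt`, for every `W`);
  3. the **`p`-adic local constancy of the Atkin–Lehner sign at `p = 2, 3`**: for every elliptic
     equation `X` over `ℚ_p` with `p`-integral coefficients there is `n` such that any two elliptic
     `W₁, W₂ / ℚ` within `exp(−n)` of `X` coefficientwise have the same sign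
     `[p ∣ N_W ? λ(Q_p)(f_W) : 1]`. This is Helfgott 2004, Prop. 4.2 / proof of Prop. 4.3 /
     Lemma 4.4 for `K = ℚ₂, ℚ₃` (local constancy of the Deligne–Langlands local constant
     `W(E/K)`, via the Tate module as a representation of the Weil group) read through
     Kellock–Dokchitser's Rem. 2.2 (`W(E/ℚ_p) = λ(Q_p)(f_E)`, local–global compatibility); the
     tree has neither the local constant of an elliptic curve over `ℚ₂, ℚ₃` nor that
     compatibility, so this — and only this — is taken as a hypothesis; the rest of the deduction
     of the named fact is proved here and in `RootNumberLocalConstancyProofs`.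
* `exists_local_tables_two_three_of_locallyConstant_residual` — in particular the same three
  inputs give `exists_local_tables_two_three` (its own residual input, the locality of
  `λ(Q_p)(f_E)` in the `ℚ_p`-isomorphism class at additive `p ∈ {2, 3}`, is implied by 3).

## The argument (Helfgott 2004, §4, over `ℚ`)

The tables above `2, 3` are built by `exists_table_of_locallyConstant`: a `±1`-valued invariant `a`
of elliptic curves over `ℚ` (here the integer Atkin–Lehner sign; `λ(Q_p) = ±1`, Knapp 1993,
Thm. 9.27(b)) which is invariant under changes of variables over `ℚ` and `v`-adically locally
constant around every `v`-integral elliptic equation over `ℚ_v` extends to a `±1`-valued,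
`ℚ_v`-invariant, locally constant table `w_v` on Weierstrass curves over `ℚ_v` with
`w_v(W ×_ℚ ℚ_v) = a(W)`: `w_v(X)` is the eventual value of `a` on rational elliptic curves
approximating a `v`-integral model of `X`. The ingredients, all proved here:

* `adicCompletion_exists_rat_curve_variableChange_near` — `ℚ⁹` is dense in `ℚ_v⁹`
  (`IsDedekindDomain.HeightOneSpectrum.denseRange_algebraMap`, `dense_pi`) and the coefficients of
  `C • X` are polynomials in `(u⁻¹, r, s, t, a₁, …, a₆)` (Silverman AEC III.1, Table 3.1), hence
  continuous: a Weierstrass equation and a change of variables over `ℚ_v` are simultaneously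
  approximated by rational ones, together with the transformed equations;
* `adicCompletion_exists_forall_near_Δ_ne_zero` — equations near a non-singular integral equation
  are non-singular (step (iii) of the proof of Helfgott's Prop. 4.2; `Δ` is an integer polynomial
  in the coefficients, `WeierstrassCurve.valuation_Δ_sub_le_and_c₄_sub_le`);
* `eq_of_eventuallyEq_of_smul_eq` — the eventual value of `a` is the same at `ℚ_v`-isomorphic
  equations (rational changes of variables approximate `C`, and `a(C' • W) = a(W)`);
* the ultrametric inequality for the local constancy of the extended table;
* invariance of the Atkin–Lehner sign under changes of variables over `ℚ`: `N_{C • W} = N_W`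
  (`WeierstrassCurve.conductorNorm_smul`, Tate's algorithm is well defined, file
  `RootNumberSmulProofs`) and `L(C • W, s) = L(W, s)` (`WeierstrassCurve.LFunction_smul`), so
  `C • W` and `W` have the same newform (the level is transported along `N_{C • W} = N_W`).

Above `p ≥ 5` the tables are Rohrlich's `localRootNumber (O_v)` exactly as in
`exists_local_tables_two_three_of_atkinLehner`, locally constant by
`localRootNumber_adicCompletion_locallyConstant`; the product formula is
`rootNumber_eq_neg_finprod_of_exists_isNewformOf`.

So the trust base of `Helfgott2004_exists_local_tables_locallyConstant` in the tree is {Modularity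
(`exists_isNewformOf`), Kellock–Dokchitser Rem. 2.2 above `p ≥ 5`
(`WeierstrassCurve.atkinLehnerEigenvalueAt_eq_localRootNumberAt`), `p`-adic local constancy of
`λ(Q_p)(f_E)` in `E ×_ℚ ℚ_p` at `p ∈ {2, 3}` (Helfgott §4 at `v ∣ 6` + local Langlands)}; the
discharge `Helfgott2004_exists_local_tables_locallyConstant_holds` is blocked upstream on
`exists_isNewformOf` (as is `exists_local_tables_two_three`, which it implies).

## References

* [Helfgott2004RootNumberFamilies] H. A. Helfgott, *On the behaviour of root numbers in families
  of elliptic curves*, arXiv:math/0408141 (2004), §4: Prop. 4.2 and its proof (steps (i)–(vi)),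
  Prop. 4.3 (proof, last paragraph), Lemma 4.4 (held copy `paper:arxiv-math_0408141`, PDF
  pp. 10–11).
* [KellockDokchitser2023] L. Cowland Kellock, V. Dokchitser, *Root numbers and parity phenomena*,
  Bull. Lond. Math. Soc. 55 (2023), 2557–2597, Def. 2.1, Rem. 2.2, Thm. 2.3, proof of Lemma 2.6
  (PDF pp. 7–8 of `paper:arxiv-2303.07883`).
* [Knapp1993] A. W. Knapp, *Elliptic curves*, Math. Notes 40 (1993), Thm. 9.27.
* [BCDTJAMS2001] C. Breuil, B. Conrad, F. Diamond, R. Taylor, JAMS 14 (2001), Thm. A.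
* [SilvermanAEC2009] J. H. Silverman, *The Arithmetic of Elliptic Curves*, GTM 106, 2nd ed. 2009,
  III.1 Table 3.1 (transformation formulae), VII.1 Prop. 1.3, App. C §16.
* [Rohrlich1993Compositio] D. Rohrlich, Compositio Math. 87 (1993), Prop. 2.
-/

noncomputable section

open scoped Classical MatrixGroups
open CongruenceSubgroup Literature.NumberTheory.EllipticCurves.ModularForms IsDedekindDomain
  IsDedekindDomain.HeightOneSpectrum Rat.HeightOneSpectrum WeierstrassCurve

namespace Literature.NumberTheory.EllipticCurves

variable (v : HeightOneSpectrum ℤ)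

/-- For every `z ≠ 0` in `ℚ_v` and every `n` there is a non-zero `t ∈ ℚ_v` with `v(t) ≤ v(z)`,
`v(t) ≤ exp(-n)` (and so `v(t) ≤ 1`). [folklore] -/
theorem adicCompletion_exists_valued_le_and_le_exp_neg {z : v.adicCompletion ℚ} (hz : z ≠ 0)
    (n : ℕ) : ∃ t : v.adicCompletion ℚ, t ≠ 0 ∧ Valued.v t ≤ Valued.v z ∧
      Valued.v t ≤ WithZero.exp (-(n : ℤ)) ∧ Valued.v t ≤ 1 := by
  obtain ⟨p, hp0, hp1⟩ := adicCompletion_exists_valued_le_exp_neg_one v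
  have hppow : ∀ m : ℕ, Valued.v (p ^ m) ≤ WithZero.exp (-(m : ℤ)) := fun m => by
    rw [Valuation.map_pow, show (-(m : ℤ)) = m • (-1 : ℤ) by simp, WithZero.exp_nsmul]
    exact pow_le_pow_left' hp1 m
  have hp1' : Valued.v p ≤ 1 :=
    hp1.trans (by rw [← WithZero.exp_zero]; exact WithZero.exp_le_exp.2 (by norm_num))
  set M : ℕ := (WithZero.log (Valued.v z)).toNat with hM
  have hzexp : Valued.v z = WithZero.exp (WithZero.log (Valued.v z)) :=
    (WithZero.exp_log ((Valuation.ne_zero_iff _).2 hz)).symm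
  have ht : Valued.v (z * p ^ (n + M)) ≤ WithZero.exp (-(n : ℤ)) := by
    rw [Valuation.map_mul]
    calc Valued.v z * Valued.v (p ^ (n + M))
        ≤ Valued.v z * WithZero.exp (-((n + M : ℕ) : ℤ)) := by gcongr; exact hppow _
      _ = WithZero.exp (WithZero.log (Valued.v z) + -((n + M : ℕ) : ℤ)) := by
          rw [WithZero.exp_add, ← hzexp]
      _ ≤ WithZero.exp (-(n : ℤ)) := WithZero.exp_le_exp.2 (by
          have := Int.self_le_toNat (WithZero.log (Valued.v z)); push_cast; omega)
  refine ⟨z * p ^ (n + M), mul_ne_zero hz (pow_ne_zero _ hp0), ?_, ht, ht.trans ?_⟩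
  · rw [Valuation.map_mul]
    exact mul_le_of_le_one_right' ((Valuation.map_pow _ _ _).le.trans (pow_le_one' hp1' _))
  · rw [← WithZero.exp_zero]; exact WithZero.exp_le_exp.2 (by omega)

/-- Preimages of open balls of `ℚ_v` under continuous maps are open. [folklore] -/
theorem isOpen_setOf_valued_sub_lt {X : Type*} [TopologicalSpace X] {f : X → v.adicCompletion ℚ}
    (hf : Continuous f) (c z : v.adicCompletion ℚ) :
    IsOpen {x : X | Valued.v (f x - c) < Valued.v z} :=
  (adicCompletion_isOpen_setOf_valued_lt v z).preimage (hf.sub continuous_const)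

/-- **`ℚ` is dense in `ℚ_v`, for Weierstrass equations and changes of variables at once.** Given a
Weierstrass equation `X` and a change of variables `C` over `ℚ_v` and thresholds `z₁, z₂ ≠ 0`,
there are a Weierstrass equation `W` and a change of variables `C'` over `ℚ` such that `W` is within
`v(z₁)` of `X`, and both `C' • W` and `C' • X` are within `v(z₂)` of `C • X` (coefficientwise): the
coefficients of `C • X` are polynomials in `(u⁻¹, r, s, t, a₁, …, a₆)` (Silverman AEC III.1,
Table 3.1), hence continuous on `ℚ_v⁹`, and `ℚ⁹` is dense in `ℚ_v⁹`. [folklore] -/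
theorem adicCompletion_exists_rat_curve_variableChange_near
    (X : WeierstrassCurve (v.adicCompletion ℚ)) (C : VariableChange (v.adicCompletion ℚ))
    {z₁ z₂ : v.adicCompletion ℚ} (hz₁ : z₁ ≠ 0) (hz₂ : z₂ ≠ 0) :
    ∃ (W : WeierstrassCurve ℚ) (C' : VariableChange ℚ),
      (Valued.v ((W.baseChange (v.adicCompletion ℚ)).a₁ - X.a₁) < Valued.v z₁ ∧
        Valued.v ((W.baseChange (v.adicCompletion ℚ)).a₂ - X.a₂) < Valued.v z₁ ∧
        Valued.v ((W.baseChange (v.adicCompletion ℚ)).a₃ - X.a₃) < Valued.v z₁ ∧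
        Valued.v ((W.baseChange (v.adicCompletion ℚ)).a₄ - X.a₄) < Valued.v z₁ ∧
        Valued.v ((W.baseChange (v.adicCompletion ℚ)).a₆ - X.a₆) < Valued.v z₁) ∧
      (Valued.v (((C' • W).baseChange (v.adicCompletion ℚ)).a₁ - (C • X).a₁) < Valued.v z₂ ∧
        Valued.v (((C' • W).baseChange (v.adicCompletion ℚ)).a₂ - (C • X).a₂) < Valued.v z₂ ∧
        Valued.v (((C' • W).baseChange (v.adicCompletion ℚ)).a₃ - (C • X).a₃) < Valued.v z₂ ∧
        Valued.v (((C' • W).baseChange (v.adicCompletion ℚ)).a₄ - (C • X).a₄) < Valued.v z₂ ∧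
        Valued.v (((C' • W).baseChange (v.adicCompletion ℚ)).a₆ - (C • X).a₆) < Valued.v z₂) ∧
      (Valued.v ((C'.map (algebraMap ℚ (v.adicCompletion ℚ)) • X).a₁ - (C • X).a₁) < Valued.v z₂ ∧
        Valued.v ((C'.map (algebraMap ℚ (v.adicCompletion ℚ)) • X).a₂ - (C • X).a₂) < Valued.v z₂ ∧
        Valued.v ((C'.map (algebraMap ℚ (v.adicCompletion ℚ)) • X).a₃ - (C • X).a₃) < Valued.v z₂ ∧
        Valued.v ((C'.map (algebraMap ℚ (v.adicCompletion ℚ)) • X).a₄ - (C • X).a₄) < Valued.v z₂ ∧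
        Valued.v ((C'.map (algebraMap ℚ (v.adicCompletion ℚ)) • X).a₆ - (C • X).a₆) < Valued.v z₂) := by
  -- the point `x₀ = (u⁻¹, r, s, t, a₁, a₂, a₃, a₄, a₆)` of `ℚ_v⁹`
  set x₀ : Fin 9 → v.adicCompletion ℚ :=
    ![((C.u⁻¹ : (v.adicCompletion ℚ)ˣ) : v.adicCompletion ℚ), C.r, C.s, C.t, X.a₁, X.a₂, X.a₃,
      X.a₄, X.a₆] with hx₀
  -- the five coefficient polynomials of a change of variables (Silverman AEC III.1, Table 3.1)
  obtain ⟨Φ₁, hΦ₁⟩ : ∃ Φ : (Fin 9 → v.adicCompletion ℚ) → v.adicCompletion ℚ, ∀ x,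
      Φ x = x 0 * (x 4 + 2 * x 2) := ⟨_, fun _ => rfl⟩
  obtain ⟨Φ₂, hΦ₂⟩ : ∃ Φ : (Fin 9 → v.adicCompletion ℚ) → v.adicCompletion ℚ, ∀ x,
      Φ x = x 0 ^ 2 * (x 5 - x 2 * x 4 + 3 * x 1 - x 2 ^ 2) := ⟨_, fun _ => rfl⟩
  obtain ⟨Φ₃, hΦ₃⟩ : ∃ Φ : (Fin 9 → v.adicCompletion ℚ) → v.adicCompletion ℚ, ∀ x,
      Φ x = x 0 ^ 3 * (x 6 + x 1 * x 4 + 2 * x 3) := ⟨_, fun _ => rfl⟩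
  obtain ⟨Φ₄, hΦ₄⟩ : ∃ Φ : (Fin 9 → v.adicCompletion ℚ) → v.adicCompletion ℚ, ∀ x,
      Φ x = x 0 ^ 4 * (x 7 - x 2 * x 6 + 2 * x 1 * x 5 - (x 3 + x 1 * x 2) * x 4 + 3 * x 1 ^ 2
        - 2 * x 2 * x 3) := ⟨_, fun _ => rfl⟩
  obtain ⟨Φ₆, hΦ₆⟩ : ∃ Φ : (Fin 9 → v.adicCompletion ℚ) → v.adicCompletion ℚ, ∀ x,
      Φ x = x 0 ^ 6 * (x 8 + x 1 * x 7 + x 1 ^ 2 * x 5 + x 1 ^ 3 - x 3 * x 6 - x 3 ^ 2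
        - x 1 * x 3 * x 4) := ⟨_, fun _ => rfl⟩
  -- freezing the curve variables at the coefficients of `X`
  obtain ⟨π, cπ, hπ⟩ : ∃ π : (Fin 9 → v.adicCompletion ℚ) → (Fin 9 → v.adicCompletion ℚ),
      Continuous π ∧ ∀ x, π x = ![x 0, x 1, x 2, x 3, X.a₁, X.a₂, X.a₃, X.a₄, X.a₆] := by
    refine ⟨fun x => ![x 0, x 1, x 2, x 3, X.a₁, X.a₂, X.a₃, X.a₄, X.a₆], ?_, fun _ => rfl⟩
    refine continuous_pi fun i => ?_
    fin_cases i <;> simp <;> fun_prop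
  have hπx₀ : π x₀ = x₀ := by
    ext i; fin_cases i <;> simp [hπ, hx₀]
  -- the values at `x₀` are the coefficients of `C • X`
  have eΦ₁ : Φ₁ x₀ = (C • X).a₁ := by rw [hΦ₁, variableChange_a₁]; simp [hx₀]
  have eΦ₂ : Φ₂ x₀ = (C • X).a₂ := by rw [hΦ₂, variableChange_a₂]; simp [hx₀]
  have eΦ₃ : Φ₃ x₀ = (C • X).a₃ := by rw [hΦ₃, variableChange_a₃]; simp [hx₀]
  have eΦ₄ : Φ₄ x₀ = (C • X).a₄ := by rw [hΦ₄, variableChange_a₄]; simp [hx₀]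
  have eΦ₆ : Φ₆ x₀ = (C • X).a₆ := by rw [hΦ₆, variableChange_a₆]; simp [hx₀]
  -- the polynomials are continuous
  have cΦ₁ : Continuous Φ₁ := by rw [funext hΦ₁]; fun_prop
  have cΦ₂ : Continuous Φ₂ := by rw [funext hΦ₂]; fun_prop
  have cΦ₃ : Continuous Φ₃ := by rw [funext hΦ₃]; fun_prop
  have cΦ₄ : Continuous Φ₄ := by rw [funext hΦ₄]; fun_prop
  have cΦ₆ : Continuous Φ₆ := by rw [funext hΦ₆]; fun_prop
  -- the open neighbourhood `N` of `x₀` cut out by the fifteen closeness conditions and `x 0 ≠ 0`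
  set N : Set (Fin 9 → v.adicCompletion ℚ) :=
    {x | Valued.v (x 4 - X.a₁) < Valued.v z₁} ∩ {x | Valued.v (x 5 - X.a₂) < Valued.v z₁} ∩
    {x | Valued.v (x 6 - X.a₃) < Valued.v z₁} ∩ {x | Valued.v (x 7 - X.a₄) < Valued.v z₁} ∩
    {x | Valued.v (x 8 - X.a₆) < Valued.v z₁} ∩
    {x | Valued.v (Φ₁ x - (C • X).a₁) < Valued.v z₂} ∩
    {x | Valued.v (Φ₂ x - (C • X).a₂) < Valued.v z₂} ∩
    {x | Valued.v (Φ₃ x - (C • X).a₃) < Valued.v z₂} ∩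
    {x | Valued.v (Φ₄ x - (C • X).a₄) < Valued.v z₂} ∩
    {x | Valued.v (Φ₆ x - (C • X).a₆) < Valued.v z₂} ∩
    {x | Valued.v ((Φ₁ ∘ π) x - (C • X).a₁) < Valued.v z₂} ∩
    {x | Valued.v ((Φ₂ ∘ π) x - (C • X).a₂) < Valued.v z₂} ∩
    {x | Valued.v ((Φ₃ ∘ π) x - (C • X).a₃) < Valued.v z₂} ∩
    {x | Valued.v ((Φ₄ ∘ π) x - (C • X).a₄) < Valued.v z₂} ∩
    {x | Valued.v ((Φ₆ ∘ π) x - (C • X).a₆) < Valued.v z₂} ∩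
    {x | Valued.v (x 0 - ((C.u⁻¹ : (v.adicCompletion ℚ)ˣ) : v.adicCompletion ℚ)) <
      Valued.v ((C.u⁻¹ : (v.adicCompletion ℚ)ˣ) : v.adicCompletion ℚ)} with hN
  have hNo : IsOpen N :=
    (((((((((((((((isOpen_setOf_valued_sub_lt v (continuous_apply 4) _ _).inter
      (isOpen_setOf_valued_sub_lt v (continuous_apply 5) _ _)).inter
      (isOpen_setOf_valued_sub_lt v (continuous_apply 6) _ _)).inter
      (isOpen_setOf_valued_sub_lt v (continuous_apply 7) _ _)).inter
      (isOpen_setOf_valued_sub_lt v (continuous_apply 8) _ _)).inter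
      (isOpen_setOf_valued_sub_lt v cΦ₁ _ _)).inter
      (isOpen_setOf_valued_sub_lt v cΦ₂ _ _)).inter
      (isOpen_setOf_valued_sub_lt v cΦ₃ _ _)).inter
      (isOpen_setOf_valued_sub_lt v cΦ₄ _ _)).inter
      (isOpen_setOf_valued_sub_lt v cΦ₆ _ _)).inter
      (isOpen_setOf_valued_sub_lt v (cΦ₁.comp cπ) _ _)).inter
      (isOpen_setOf_valued_sub_lt v (cΦ₂.comp cπ) _ _)).inter
      (isOpen_setOf_valued_sub_lt v (cΦ₃.comp cπ) _ _)).inter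
      (isOpen_setOf_valued_sub_lt v (cΦ₄.comp cπ) _ _)).inter
      (isOpen_setOf_valued_sub_lt v (cΦ₆.comp cπ) _ _)).inter
      (isOpen_setOf_valued_sub_lt v (continuous_apply 0) _ _)
  have hz : ∀ {z : v.adicCompletion ℚ}, z ≠ 0 → ∀ a : v.adicCompletion ℚ,
      Valued.v (a - a) < Valued.v z := fun hz a => by
    rw [sub_self, Valuation.map_zero]; exact (Valuation.pos_iff _).2 hz
  have hx₀N : x₀ ∈ N := by
    simp only [hN, Set.mem_inter_iff, Set.mem_setOf_eq, Function.comp_apply, hπx₀, eΦ₁, eΦ₂, eΦ₃,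
      eΦ₄, eΦ₆]
    have e4 : x₀ 4 = X.a₁ := by simp [hx₀]
    have e5 : x₀ 5 = X.a₂ := by simp [hx₀]
    have e6 : x₀ 6 = X.a₃ := by simp [hx₀]
    have e7 : x₀ 7 = X.a₄ := by simp [hx₀]
    have e8 : x₀ 8 = X.a₆ := by simp [hx₀]
    have e0 : x₀ 0 = ((C.u⁻¹ : (v.adicCompletion ℚ)ˣ) : v.adicCompletion ℚ) := by simp [hx₀]
    rw [e4, e5, e6, e7, e8, e0]
    exact ⟨⟨⟨⟨⟨⟨⟨⟨⟨⟨⟨⟨⟨⟨⟨hz hz₁ _, hz hz₁ _⟩, hz hz₁ _⟩, hz hz₁ _⟩, hz hz₁ _⟩, hz hz₂ _⟩,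
      hz hz₂ _⟩, hz hz₂ _⟩, hz hz₂ _⟩, hz hz₂ _⟩, hz hz₂ _⟩, hz hz₂ _⟩, hz hz₂ _⟩, hz hz₂ _⟩,
      hz hz₂ _⟩, hz (Units.ne_zero _) _⟩
  -- `ℚ⁹` is dense in `ℚ_v⁹`: pick a rational point `x` of `N`
  have hD : Dense (Set.pi Set.univ fun _ : Fin 9 => Set.range (algebraMap ℚ (v.adicCompletion ℚ))) :=
    dense_pi Set.univ fun _ _ => HeightOneSpectrum.denseRange_algebraMap ℚ v
  obtain ⟨x, hxN, hxD⟩ := hD.inter_open_nonempty N hNo ⟨x₀, hx₀N⟩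
  have hq : ∀ i, ∃ q : ℚ, algebraMap ℚ (v.adicCompletion ℚ) q = x i :=
    fun i => hxD i (Set.mem_univ _)
  choose q hq using hq
  simp only [hN, Set.mem_inter_iff, Set.mem_setOf_eq, Function.comp_apply] at hxN
  obtain ⟨⟨⟨⟨⟨⟨⟨⟨⟨⟨⟨⟨⟨⟨⟨hA1, hA2⟩, hA3⟩, hA4⟩, hA6⟩, hB1⟩, hB2⟩, hB3⟩, hB4⟩, hB6⟩, hC1⟩, hC2⟩,
    hC3⟩, hC4⟩, hC6⟩, hD0⟩ := hxN
  -- `q 0 ≠ 0`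
  have hx0 : x 0 ≠ 0 := by
    have h := Valuation.map_eq_of_sub_lt _ hD0
    intro h0
    rw [h0, Valuation.map_zero] at h
    exact (Valuation.ne_zero_iff _).2 (Units.ne_zero _) h.symm
  have hq0 : q 0 ≠ 0 := by
    intro h0; apply hx0; rw [← hq 0, h0, map_zero]
  -- the rational curve and change of variables
  set W : WeierstrassCurve ℚ := ⟨q 4, q 5, q 6, q 7, q 8⟩ with hW
  set C' : VariableChange ℚ := ⟨(Units.mk0 (q 0) hq0)⁻¹, q 1, q 2, q 3⟩ with hC'
  have eA1 : (W.baseChange (v.adicCompletion ℚ)).a₁ = x 4 := hq 4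
  have eA2 : (W.baseChange (v.adicCompletion ℚ)).a₂ = x 5 := hq 5
  have eA3 : (W.baseChange (v.adicCompletion ℚ)).a₃ = x 6 := hq 6
  have eA4 : (W.baseChange (v.adicCompletion ℚ)).a₄ = x 7 := hq 7
  have eA6 : (W.baseChange (v.adicCompletion ℚ)).a₆ = x 8 := hq 8
  have eB1 : ((C' • W).baseChange (v.adicCompletion ℚ)).a₁ = Φ₁ x := by
    show algebraMap ℚ _ (C' • W).a₁ = _
    rw [hΦ₁, variableChange_a₁]
    simp only [hW, hC', inv_inv, Units.val_mk0, map_mul, map_add, map_ofNat,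
      hq]
  have eB2 : ((C' • W).baseChange (v.adicCompletion ℚ)).a₂ = Φ₂ x := by
    show algebraMap ℚ _ (C' • W).a₂ = _
    rw [hΦ₂, variableChange_a₂]
    simp only [hW, hC', inv_inv, Units.val_mk0, map_mul, map_add, map_sub, map_pow, map_ofNat,
      hq]
  have eB3 : ((C' • W).baseChange (v.adicCompletion ℚ)).a₃ = Φ₃ x := by
    show algebraMap ℚ _ (C' • W).a₃ = _
    rw [hΦ₃, variableChange_a₃]
    simp only [hW, hC', inv_inv, Units.val_mk0, map_mul, map_add, map_pow, map_ofNat,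
      hq]
  have eB4 : ((C' • W).baseChange (v.adicCompletion ℚ)).a₄ = Φ₄ x := by
    show algebraMap ℚ _ (C' • W).a₄ = _
    rw [hΦ₄, variableChange_a₄]
    simp only [hW, hC', inv_inv, Units.val_mk0, map_mul, map_add, map_sub, map_pow, map_ofNat,
      hq]
  have eB6 : ((C' • W).baseChange (v.adicCompletion ℚ)).a₆ = Φ₆ x := by
    show algebraMap ℚ _ (C' • W).a₆ = _
    rw [hΦ₆, variableChange_a₆]
    simp only [hW, hC', inv_inv, Units.val_mk0, map_mul, map_add, map_sub, map_pow,
      hq]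
  have hπ0 : π x 0 = x 0 := by simp [hπ]
  have hπ1 : π x 1 = x 1 := by simp [hπ]
  have hπ2 : π x 2 = x 2 := by simp [hπ]
  have hπ3 : π x 3 = x 3 := by simp [hπ]
  have hπ4 : π x 4 = X.a₁ := by simp [hπ]
  have hπ5 : π x 5 = X.a₂ := by simp [hπ]
  have hπ6 : π x 6 = X.a₃ := by simp [hπ]
  have hπ7 : π x 7 = X.a₄ := by simp [hπ]
  have hπ8 : π x 8 = X.a₆ := by simp [hπ]
  have eC1 : (C'.map (algebraMap ℚ (v.adicCompletion ℚ)) • X).a₁ = Φ₁ (π x) := by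
    rw [hΦ₁, variableChange_a₁, hπ0, hπ2, hπ4]
    simp only [hC', VariableChange.map_u, VariableChange.map_s,
      Units.coe_map_inv, inv_inv, Units.val_mk0, MonoidHom.coe_coe, hq]
  have eC2 : (C'.map (algebraMap ℚ (v.adicCompletion ℚ)) • X).a₂ = Φ₂ (π x) := by
    rw [hΦ₂, variableChange_a₂, hπ0, hπ1, hπ2, hπ4, hπ5]
    simp only [hC', VariableChange.map_u, VariableChange.map_r, VariableChange.map_s,
      Units.coe_map_inv, inv_inv, Units.val_mk0, MonoidHom.coe_coe, hq]
  have eC3 : (C'.map (algebraMap ℚ (v.adicCompletion ℚ)) • X).a₃ = Φ₃ (π x) := by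
    rw [hΦ₃, variableChange_a₃, hπ0, hπ1, hπ3, hπ4, hπ6]
    simp only [hC', VariableChange.map_u, VariableChange.map_r,
      VariableChange.map_t, Units.coe_map_inv, inv_inv, Units.val_mk0, MonoidHom.coe_coe, hq]
  have eC4 : (C'.map (algebraMap ℚ (v.adicCompletion ℚ)) • X).a₄ = Φ₄ (π x) := by
    rw [hΦ₄, variableChange_a₄, hπ0, hπ1, hπ2, hπ3, hπ4, hπ5, hπ6, hπ7]
    simp only [hC', VariableChange.map_u, VariableChange.map_r, VariableChange.map_s,
      VariableChange.map_t, Units.coe_map_inv, inv_inv, Units.val_mk0, MonoidHom.coe_coe, hq]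
  have eC6 : (C'.map (algebraMap ℚ (v.adicCompletion ℚ)) • X).a₆ = Φ₆ (π x) := by
    rw [hΦ₆, variableChange_a₆, hπ0, hπ1, hπ3, hπ4, hπ5, hπ6, hπ7, hπ8]
    simp only [hC', VariableChange.map_u, VariableChange.map_r,
      VariableChange.map_t, Units.coe_map_inv, inv_inv, Units.val_mk0, MonoidHom.coe_coe, hq]
  refine ⟨W, C', ?_, ?_, ?_⟩
  · rw [eA1, eA2, eA3, eA4, eA6]; exact ⟨hA1, hA2, hA3, hA4, hA6⟩
  · rw [eB1, eB2, eB3, eB4, eB6]; exact ⟨hB1, hB2, hB3, hB4, hB6⟩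
  · rw [eC1, eC2, eC3, eC4, eC6]; exact ⟨hC1, hC2, hC3, hC4, hC6⟩


/-- A Weierstrass equation over `ℚ` whose base change to `ℚ_v` has non-zero discriminant is
elliptic. [folklore] -/
theorem isElliptic_of_baseChange_adicCompletion_Δ_ne_zero {W : WeierstrassCurve ℚ}
    (h : (W.baseChange (v.adicCompletion ℚ)).Δ ≠ 0) : W.IsElliptic := by
  rw [WeierstrassCurve.isElliptic_iff, isUnit_iff_ne_zero]
  intro h0
  apply h
  rw [show (W.baseChange (v.adicCompletion ℚ)).Δ = algebraMap ℚ _ W.Δ from W.map_Δ _, h0, map_zero]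

/-- **Equations near a non-singular `v`-integral equation are non-singular**: if `X` has
coefficients in `O_v` and `Δ(X) ≠ 0`, there is `z ≠ 0` such that every `Y` with
`v(aⱼ(Y) − aⱼ(X)) < v(z)` (`j = 1, 2, 3, 4, 6`) has `Δ(Y) ≠ 0` (the proof gives
`v(Δ(Y)) = v(Δ(X))`) — `Δ` is an integer polynomial in the coefficients, so
`v(Δ(Y) − Δ(X)) ≤ max v(aⱼ(Y) − aⱼ(X)) < v(Δ(X))` for `z` small
(`WeierstrassCurve.valuation_Δ_sub_le_and_c₄_sub_le` over the discrete valuation ring `O_v`, whose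
`𝔪`-adic valuation is equivalent to `Valued.v`). Step (iii) of the proof of Helfgott 2004, Prop. 4.2.
[cite: Helfgott2004RootNumberFamilies, §4 proof of Prop. 4.2] -/
theorem adicCompletion_exists_forall_near_Δ_ne_zero (X : WeierstrassCurve (v.adicCompletion ℚ))
    (h₁ : X.a₁ ∈ v.adicCompletionIntegers ℚ) (h₂ : X.a₂ ∈ v.adicCompletionIntegers ℚ)
    (h₃ : X.a₃ ∈ v.adicCompletionIntegers ℚ) (h₄ : X.a₄ ∈ v.adicCompletionIntegers ℚ)
    (h₆ : X.a₆ ∈ v.adicCompletionIntegers ℚ) (hΔ : X.Δ ≠ 0) :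
    ∃ z : v.adicCompletion ℚ, z ≠ 0 ∧ ∀ Y : WeierstrassCurve (v.adicCompletion ℚ),
      Valued.v (Y.a₁ - X.a₁) < Valued.v z → Valued.v (Y.a₂ - X.a₂) < Valued.v z →
      Valued.v (Y.a₃ - X.a₃) < Valued.v z → Valued.v (Y.a₄ - X.a₄) < Valued.v z →
      Valued.v (Y.a₆ - X.a₆) < Valued.v z → Y.Δ ≠ 0 := by
  haveI : IsIntegral (v.adicCompletionIntegers ℚ) X :=
    isIntegral_of_exists_lift _ ⟨⟨_, h₁⟩, rfl⟩ ⟨⟨_, h₂⟩, rfl⟩ ⟨⟨_, h₃⟩, rfl⟩ ⟨⟨_, h₄⟩, rfl⟩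
      ⟨⟨_, h₆⟩, rfl⟩
  have hE := isEquiv_valuation_maximalIdeal_of_le_one_iff
    (valued_le_one_iff_mem_range_adicCompletionIntegers (K := ℚ) v)
  set ν := valuation (v.adicCompletion ℚ)
    (IsDiscreteValuationRing.maximalIdeal (v.adicCompletionIntegers ℚ)) with hν
  obtain ⟨N, hN⟩ := WithZero.exists_exp_neg_natCast_lt ((Valuation.ne_zero_iff ν).2 hΔ)
  obtain ⟨π, hπ⟩ := valuation_exists_uniformizer (v.adicCompletion ℚ)
    (IsDiscreteValuationRing.maximalIdeal (v.adicCompletionIntegers ℚ))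
  have hπN : ν (π ^ N) = WithZero.exp (-(N : ℤ)) := by
    rw [map_pow, hν, hπ, ← WithZero.exp_nsmul]; simp
  have hπ0 : π ≠ 0 := by
    intro h0; rw [h0, map_zero] at hπ; exact WithZero.exp_ne_zero hπ.symm
  have hN1 : WithZero.exp (-(N : ℤ)) ≤ 1 := by
    rw [← WithZero.exp_zero]; exact WithZero.exp_le_exp.2 (by omega)
  refine ⟨π ^ N, pow_ne_zero _ hπ0, fun Y k₁ k₂ k₃ k₄ k₆ => ?_⟩
  have k₁' : ν (Y.a₁ - X.a₁) < WithZero.exp (-(N : ℤ)) := hπN ▸ hE.lt_iff_lt.2 k₁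
  have k₂' : ν (Y.a₂ - X.a₂) < WithZero.exp (-(N : ℤ)) := hπN ▸ hE.lt_iff_lt.2 k₂
  have k₃' : ν (Y.a₃ - X.a₃) < WithZero.exp (-(N : ℤ)) := hπN ▸ hE.lt_iff_lt.2 k₃
  have k₄' : ν (Y.a₄ - X.a₄) < WithZero.exp (-(N : ℤ)) := hπN ▸ hE.lt_iff_lt.2 k₄
  have k₆' : ν (Y.a₆ - X.a₆) < WithZero.exp (-(N : ℤ)) := hπN ▸ hE.lt_iff_lt.2 k₆
  haveI : IsIntegral (v.adicCompletionIntegers ℚ) Y :=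
    isIntegral_of_valuation_sub_le_one (v.adicCompletionIntegers ℚ) (k₁'.le.trans hN1)
      (k₂'.le.trans hN1) (k₃'.le.trans hN1) (k₄'.le.trans hN1) (k₆'.le.trans hN1)
  obtain ⟨hΔsub, -⟩ := valuation_Δ_sub_le_and_c₄_sub_le (v.adicCompletionIntegers ℚ) k₁'.le
    k₂'.le k₃'.le k₄'.le k₆'.le
  have heq : ν Y.Δ = ν X.Δ := Valuation.map_eq_of_sub_lt _ (hΔsub.trans_lt hN)
  exact (Valuation.ne_zero_iff ν).1 (heq ▸ (Valuation.ne_zero_iff ν).2 hΔ)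

/-- **Rational elliptic curves approximate `v`-integral elliptic equations over `ℚ_v`**: for `X`
with coefficients in `O_v`, `Δ(X) ≠ 0`, and any `n`, there is an elliptic `W / ℚ` with
`v(aⱼ(W) − aⱼ(X)) < exp(−n)` for `j = 1, 2, 3, 4, 6` (density of `ℚ` in `ℚ_v` and
`adicCompletion_exists_forall_near_Δ_ne_zero`). [folklore] -/
theorem adicCompletion_exists_rat_isElliptic_near (X : WeierstrassCurve (v.adicCompletion ℚ))
    (h₁ : X.a₁ ∈ v.adicCompletionIntegers ℚ) (h₂ : X.a₂ ∈ v.adicCompletionIntegers ℚ)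
    (h₃ : X.a₃ ∈ v.adicCompletionIntegers ℚ) (h₄ : X.a₄ ∈ v.adicCompletionIntegers ℚ)
    (h₆ : X.a₆ ∈ v.adicCompletionIntegers ℚ) (hΔ : X.Δ ≠ 0) (n : ℕ) :
    ∃ W : WeierstrassCurve ℚ, W.IsElliptic ∧
      Valued.v ((W.baseChange (v.adicCompletion ℚ)).a₁ - X.a₁) < WithZero.exp (-(n : ℤ)) ∧
      Valued.v ((W.baseChange (v.adicCompletion ℚ)).a₂ - X.a₂) < WithZero.exp (-(n : ℤ)) ∧
      Valued.v ((W.baseChange (v.adicCompletion ℚ)).a₃ - X.a₃) < WithZero.exp (-(n : ℤ)) ∧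
      Valued.v ((W.baseChange (v.adicCompletion ℚ)).a₄ - X.a₄) < WithZero.exp (-(n : ℤ)) ∧
      Valued.v ((W.baseChange (v.adicCompletion ℚ)).a₆ - X.a₆) < WithZero.exp (-(n : ℤ)) := by
  obtain ⟨zΔ, hzΔ0, hzΔ⟩ := adicCompletion_exists_forall_near_Δ_ne_zero v X h₁ h₂ h₃ h₄ h₆ hΔ
  obtain ⟨t, ht0, htz, htn, -⟩ := adicCompletion_exists_valued_le_and_le_exp_neg v hzΔ0 n
  obtain ⟨W, -, ⟨k₁, k₂, k₃, k₄, k₆⟩, -, -⟩ :=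
    adicCompletion_exists_rat_curve_variableChange_near v X 1 ht0 ht0
  exact ⟨W, isElliptic_of_baseChange_adicCompletion_Δ_ne_zero v (hzΔ _ (k₁.trans_le htz)
    (k₂.trans_le htz) (k₃.trans_le htz) (k₄.trans_le htz) (k₆.trans_le htz)),
    k₁.trans_le htn, k₂.trans_le htn, k₃.trans_le htn, k₄.trans_le htn, k₆.trans_le htn⟩

/-- **The eventual value is the same on `ℚ_v`-isomorphic equations** (key step). Let
`a : {Weierstrass curves over ℚ} → ℤ` be invariant under changes of variables over `ℚ` on elliptic
curves. Let `X₁` be a `v`-integral equation over `ℚ_v` with `Δ ≠ 0`, `X₂ = C • X₁` for a change of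
variables `C` over `ℚ_v`, and suppose `a` is eventually equal to `s₁` on rational elliptic curves
`v`-adically close to `X₁` and eventually equal to `s₂` on those close to `X₂`. Then `s₁ = s₂`:
choose (`adicCompletion_exists_rat_curve_variableChange_near`) a rational `W` close to `X₁` and a
rational change of variables `C'` close to `C` with `C' • W` close to `C • X₁ = X₂`; then
`s₁ = a(W) = a(C' • W) = s₂`. [folklore] -/
theorem eq_of_eventuallyEq_of_smul_eq {a : WeierstrassCurve ℚ → ℤ}
    (hiso : ∀ (W : WeierstrassCurve ℚ) (C : VariableChange ℚ), W.IsElliptic → a (C • W) = a W)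
    {X₁ X₂ : WeierstrassCurve (v.adicCompletion ℚ)}
    (h₁ : X₁.a₁ ∈ v.adicCompletionIntegers ℚ) (h₂ : X₁.a₂ ∈ v.adicCompletionIntegers ℚ)
    (h₃ : X₁.a₃ ∈ v.adicCompletionIntegers ℚ) (h₄ : X₁.a₄ ∈ v.adicCompletionIntegers ℚ)
    (h₆ : X₁.a₆ ∈ v.adicCompletionIntegers ℚ) (hΔ : X₁.Δ ≠ 0)
    {C : VariableChange (v.adicCompletion ℚ)} (hC : C • X₁ = X₂) {s₁ s₂ : ℤ} {n₁ n₂ : ℕ}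
    (hs₁ : ∀ W : WeierstrassCurve ℚ, W.IsElliptic →
      Valued.v ((W.baseChange (v.adicCompletion ℚ)).a₁ - X₁.a₁) < WithZero.exp (-(n₁ : ℤ)) →
      Valued.v ((W.baseChange (v.adicCompletion ℚ)).a₂ - X₁.a₂) < WithZero.exp (-(n₁ : ℤ)) →
      Valued.v ((W.baseChange (v.adicCompletion ℚ)).a₃ - X₁.a₃) < WithZero.exp (-(n₁ : ℤ)) →
      Valued.v ((W.baseChange (v.adicCompletion ℚ)).a₄ - X₁.a₄) < WithZero.exp (-(n₁ : ℤ)) →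
      Valued.v ((W.baseChange (v.adicCompletion ℚ)).a₆ - X₁.a₆) < WithZero.exp (-(n₁ : ℤ)) →
      a W = s₁)
    (hs₂ : ∀ W : WeierstrassCurve ℚ, W.IsElliptic →
      Valued.v ((W.baseChange (v.adicCompletion ℚ)).a₁ - X₂.a₁) < WithZero.exp (-(n₂ : ℤ)) →
      Valued.v ((W.baseChange (v.adicCompletion ℚ)).a₂ - X₂.a₂) < WithZero.exp (-(n₂ : ℤ)) →
      Valued.v ((W.baseChange (v.adicCompletion ℚ)).a₃ - X₂.a₃) < WithZero.exp (-(n₂ : ℤ)) →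
      Valued.v ((W.baseChange (v.adicCompletion ℚ)).a₄ - X₂.a₄) < WithZero.exp (-(n₂ : ℤ)) →
      Valued.v ((W.baseChange (v.adicCompletion ℚ)).a₆ - X₂.a₆) < WithZero.exp (-(n₂ : ℤ)) →
      a W = s₂) :
    s₁ = s₂ := by
  obtain ⟨zΔ, hzΔ0, hzΔ⟩ := adicCompletion_exists_forall_near_Δ_ne_zero v X₁ h₁ h₂ h₃ h₄ h₆ hΔ
  obtain ⟨t₁, ht₁0, ht₁z, ht₁n, -⟩ := adicCompletion_exists_valued_le_and_le_exp_neg v hzΔ0 n₁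
  obtain ⟨t₂, ht₂0, -, ht₂n, -⟩ := adicCompletion_exists_valued_le_and_le_exp_neg v hzΔ0 n₂
  obtain ⟨W, C', ⟨k₁, k₂, k₃, k₄, k₆⟩, ⟨l₁, l₂, l₃, l₄, l₆⟩, -⟩ :=
    adicCompletion_exists_rat_curve_variableChange_near v X₁ C ht₁0 ht₂0
  have hW : W.IsElliptic :=
    isElliptic_of_baseChange_adicCompletion_Δ_ne_zero v (hzΔ _ (k₁.trans_le ht₁z)
      (k₂.trans_le ht₁z) (k₃.trans_le ht₁z) (k₄.trans_le ht₁z) (k₆.trans_le ht₁z))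
  have e₁ : a W = s₁ := hs₁ W hW (k₁.trans_le ht₁n) (k₂.trans_le ht₁n) (k₃.trans_le ht₁n)
    (k₄.trans_le ht₁n) (k₆.trans_le ht₁n)
  haveI := hW
  rw [hC] at l₁ l₂ l₃ l₄ l₆
  have e₂ : a (C' • W) = s₂ := hs₂ (C' • W) inferInstance (l₁.trans_le ht₂n) (l₂.trans_le ht₂n)
    (l₃.trans_le ht₂n) (l₄.trans_le ht₂n) (l₆.trans_le ht₂n)
  rw [← e₁, ← e₂, hiso W C' hW]


/-- `x ∈ O_v` from `x ∈ range (O_v → ℚ_v)`. [folklore] -/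
theorem mem_adicCompletionIntegers_of_mem_range {x : v.adicCompletion ℚ}
    (h : x ∈ (algebraMap (v.adicCompletionIntegers ℚ) (v.adicCompletion ℚ)).range) :
    x ∈ v.adicCompletionIntegers ℚ := by
  obtain ⟨y, rfl⟩ := h
  exact y.2

/-- **A locally constant local invariant of elliptic curves over `ℚ` extends to a locally constant
table over `ℚ_v`.** Let `a : {Weierstrass curves over ℚ} → ℤ` be `±1`-valued on elliptic curves,
invariant under changes of variables over `ℚ`, and *`v`-adically locally constant around every
`v`-integral elliptic equation `X` over `ℚ_v`*: there is `n` such that any two rational elliptic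
curves within `exp(−n)` of `X` (coefficientwise, in `ℚ_v`) have the same value. Then there is a
`±1`-valued table `w_v : {Weierstrass curves over ℚ_v} → ℤ`, invariant under every change of
variables over `ℚ_v`, with `w_v(W ×_ℚ ℚ_v) = a(W)` for every elliptic `W / ℚ`, and locally constant
in the sense of clause (5) of `Helfgott2004_exists_local_tables_locallyConstant`. Construction:
`w_v(X)` is the eventual value of `a` on rational elliptic curves approximating a `v`-integral model
of `X` (`ℚ` is dense in `ℚ_v`); it does not depend on the model by `eq_of_eventuallyEq_of_smul_eq`
(rational changes of variables are dense in those over `ℚ_v` and the action is continuous), which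
also gives the invariance, the values on rational curves and — with the ultrametric inequality — the
local constancy. (A formalization device, not a step of Helfgott 2004, §4, where `W(E/K_v)` is
defined directly on curves over `K_v`: in the tree the local sign at `v ∣ 6` is only available on
curves over `ℚ`, as an Atkin–Lehner eigenvalue, and is extended to `ℚ_v` by density.) [folklore] -/
theorem exists_table_of_locallyConstant (a : WeierstrassCurve ℚ → ℤ)
    (ha : ∀ W : WeierstrassCurve ℚ, W.IsElliptic → a W = 1 ∨ a W = -1)
    (hiso : ∀ (W : WeierstrassCurve ℚ) (C : VariableChange ℚ), W.IsElliptic → a (C • W) = a W)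
    (hlc : ∀ X : WeierstrassCurve (v.adicCompletion ℚ), X.IsElliptic →
      X.a₁ ∈ v.adicCompletionIntegers ℚ → X.a₂ ∈ v.adicCompletionIntegers ℚ →
      X.a₃ ∈ v.adicCompletionIntegers ℚ → X.a₄ ∈ v.adicCompletionIntegers ℚ →
      X.a₆ ∈ v.adicCompletionIntegers ℚ →
      ∃ n : ℕ, ∀ W₁ W₂ : WeierstrassCurve ℚ, W₁.IsElliptic → W₂.IsElliptic →
        Valued.v ((W₁.baseChange (v.adicCompletion ℚ)).a₁ - X.a₁) < WithZero.exp (-(n : ℤ)) →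
        Valued.v ((W₁.baseChange (v.adicCompletion ℚ)).a₂ - X.a₂) < WithZero.exp (-(n : ℤ)) →
        Valued.v ((W₁.baseChange (v.adicCompletion ℚ)).a₃ - X.a₃) < WithZero.exp (-(n : ℤ)) →
        Valued.v ((W₁.baseChange (v.adicCompletion ℚ)).a₄ - X.a₄) < WithZero.exp (-(n : ℤ)) →
        Valued.v ((W₁.baseChange (v.adicCompletion ℚ)).a₆ - X.a₆) < WithZero.exp (-(n : ℤ)) →
        Valued.v ((W₂.baseChange (v.adicCompletion ℚ)).a₁ - X.a₁) < WithZero.exp (-(n : ℤ)) →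
        Valued.v ((W₂.baseChange (v.adicCompletion ℚ)).a₂ - X.a₂) < WithZero.exp (-(n : ℤ)) →
        Valued.v ((W₂.baseChange (v.adicCompletion ℚ)).a₃ - X.a₃) < WithZero.exp (-(n : ℤ)) →
        Valued.v ((W₂.baseChange (v.adicCompletion ℚ)).a₄ - X.a₄) < WithZero.exp (-(n : ℤ)) →
        Valued.v ((W₂.baseChange (v.adicCompletion ℚ)).a₆ - X.a₆) < WithZero.exp (-(n : ℤ)) →
        a W₁ = a W₂) :
    ∃ wv : WeierstrassCurve (v.adicCompletion ℚ) → ℤ,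
      (∀ X, wv X = 1 ∨ wv X = -1) ∧
      (∀ X (C : VariableChange (v.adicCompletion ℚ)), wv (C • X) = wv X) ∧
      (∀ W : WeierstrassCurve ℚ, W.IsElliptic → wv (W.baseChange (v.adicCompletion ℚ)) = a W) ∧
      ∀ X : WeierstrassCurve (v.adicCompletion ℚ), X.IsElliptic →
        X.a₁ ∈ v.adicCompletionIntegers ℚ → X.a₂ ∈ v.adicCompletionIntegers ℚ →
        X.a₃ ∈ v.adicCompletionIntegers ℚ → X.a₄ ∈ v.adicCompletionIntegers ℚ →
        X.a₆ ∈ v.adicCompletionIntegers ℚ →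
        ∃ n : ℕ, ∀ Y : WeierstrassCurve (v.adicCompletion ℚ), Y.IsElliptic →
          Y.a₁ ∈ v.adicCompletionIntegers ℚ → Y.a₂ ∈ v.adicCompletionIntegers ℚ →
          Y.a₃ ∈ v.adicCompletionIntegers ℚ → Y.a₄ ∈ v.adicCompletionIntegers ℚ →
          Y.a₆ ∈ v.adicCompletionIntegers ℚ →
          Valued.v (Y.a₁ - X.a₁) < WithZero.exp (-(n : ℤ)) →
          Valued.v (Y.a₂ - X.a₂) < WithZero.exp (-(n : ℤ)) →
          Valued.v (Y.a₃ - X.a₃) < WithZero.exp (-(n : ℤ)) →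
          Valued.v (Y.a₄ - X.a₄) < WithZero.exp (-(n : ℤ)) →
          Valued.v (Y.a₆ - X.a₆) < WithZero.exp (-(n : ℤ)) → wv Y = wv X := by
  -- `Ev X s`: `a` is eventually equal to `s` on rational elliptic curves `v`-adically close to `X`
  obtain ⟨Ev, hEv⟩ : ∃ Ev : WeierstrassCurve (v.adicCompletion ℚ) → ℤ → Prop, ∀ X s, Ev X s ↔
      ∃ n : ℕ, ∀ W : WeierstrassCurve ℚ, W.IsElliptic →
        Valued.v ((W.baseChange (v.adicCompletion ℚ)).a₁ - X.a₁) < WithZero.exp (-(n : ℤ)) →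
        Valued.v ((W.baseChange (v.adicCompletion ℚ)).a₂ - X.a₂) < WithZero.exp (-(n : ℤ)) →
        Valued.v ((W.baseChange (v.adicCompletion ℚ)).a₃ - X.a₃) < WithZero.exp (-(n : ℤ)) →
        Valued.v ((W.baseChange (v.adicCompletion ℚ)).a₄ - X.a₄) < WithZero.exp (-(n : ℤ)) →
        Valued.v ((W.baseChange (v.adicCompletion ℚ)).a₆ - X.a₆) < WithZero.exp (-(n : ℤ)) →
        a W = s := ⟨_, fun _ _ => Iff.rfl⟩
  -- (i) at a `v`-integral elliptic `X` there is an eventual value, and it is `±1`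
  have hex : ∀ X : WeierstrassCurve (v.adicCompletion ℚ), X.IsElliptic →
      X.a₁ ∈ v.adicCompletionIntegers ℚ → X.a₂ ∈ v.adicCompletionIntegers ℚ →
      X.a₃ ∈ v.adicCompletionIntegers ℚ → X.a₄ ∈ v.adicCompletionIntegers ℚ →
      X.a₆ ∈ v.adicCompletionIntegers ℚ → ∃ s : ℤ, (s = 1 ∨ s = -1) ∧ Ev X s := by
    intro X hX i₁ i₂ i₃ i₄ i₆
    haveI := hX
    obtain ⟨n, hn⟩ := hlc X hX i₁ i₂ i₃ i₄ i₆
    obtain ⟨W₀, hW₀, k₁, k₂, k₃, k₄, k₆⟩ :=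
      adicCompletion_exists_rat_isElliptic_near v X i₁ i₂ i₃ i₄ i₆ X.isUnit_Δ.ne_zero n
    exact ⟨a W₀, ha W₀ hW₀, (hEv _ _).2 ⟨n, fun W hW l₁ l₂ l₃ l₄ l₆ =>
      hn W W₀ hW hW₀ l₁ l₂ l₃ l₄ l₆ k₁ k₂ k₃ k₄ k₆⟩⟩
  -- (ii) eventual values of `ℚ_v`-isomorphic equations agree (`X₁` integral elliptic)
  have huniq : ∀ (X₁ X₂ : WeierstrassCurve (v.adicCompletion ℚ)), X₁.IsElliptic →
      X₁.a₁ ∈ v.adicCompletionIntegers ℚ → X₁.a₂ ∈ v.adicCompletionIntegers ℚ →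
      X₁.a₃ ∈ v.adicCompletionIntegers ℚ → X₁.a₄ ∈ v.adicCompletionIntegers ℚ →
      X₁.a₆ ∈ v.adicCompletionIntegers ℚ → ∀ C : VariableChange (v.adicCompletion ℚ),
      C • X₁ = X₂ → ∀ s₁ s₂ : ℤ, Ev X₁ s₁ → Ev X₂ s₂ → s₁ = s₂ := by
    intro X₁ X₂ hX₁ i₁ i₂ i₃ i₄ i₆ C hC s₁ s₂ hs₁ hs₂
    haveI := hX₁
    obtain ⟨n₁, hn₁⟩ := (hEv _ _).1 hs₁
    obtain ⟨n₂, hn₂⟩ := (hEv _ _).1 hs₂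
    exact eq_of_eventuallyEq_of_smul_eq v hiso i₁ i₂ i₃ i₄ i₆ X₁.isUnit_Δ.ne_zero hC hn₁ hn₂
  -- a `v`-integral model `D X • X` of every `X`
  have hint : ∀ X : WeierstrassCurve (v.adicCompletion ℚ), ∃ D : VariableChange (v.adicCompletion ℚ),
      (D • X).a₁ ∈ v.adicCompletionIntegers ℚ ∧ (D • X).a₂ ∈ v.adicCompletionIntegers ℚ ∧
      (D • X).a₃ ∈ v.adicCompletionIntegers ℚ ∧ (D • X).a₄ ∈ v.adicCompletionIntegers ℚ ∧
      (D • X).a₆ ∈ v.adicCompletionIntegers ℚ := by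
    intro X
    obtain ⟨D, hD⟩ := exists_isIntegral (v.adicCompletionIntegers ℚ) X
    obtain ⟨j₁, j₂, j₃, j₄, j₆⟩ := (isIntegral_iff_forall_mem_range _).1 hD
    exact ⟨D, mem_adicCompletionIntegers_of_mem_range v j₁, mem_adicCompletionIntegers_of_mem_range v j₂,
      mem_adicCompletionIntegers_of_mem_range v j₃, mem_adicCompletionIntegers_of_mem_range v j₄,
      mem_adicCompletionIntegers_of_mem_range v j₆⟩
  choose D hD₁ hD₂ hD₃ hD₄ hD₆ using hint
  -- the eventual value at the integral model of an elliptic `X`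
  have hsign : ∀ X : WeierstrassCurve (v.adicCompletion ℚ), X.IsElliptic →
      ∃ s : ℤ, (s = 1 ∨ s = -1) ∧ Ev (D X • X) s := fun X hX => by
    haveI := hX
    exact hex (D X • X) inferInstance (hD₁ X) (hD₂ X) (hD₃ X) (hD₄ X) (hD₆ X)
  choose s hs₁ hs₂ using hsign
  -- elliptic is invariant under changes of variables
  have hell : ∀ (X : WeierstrassCurve (v.adicCompletion ℚ)) (C : VariableChange (v.adicCompletion ℚ)),
      (C • X).IsElliptic → X.IsElliptic := fun X C h => by
    haveI := h
    simpa using (inferInstance : (C⁻¹ • (C • X)).IsElliptic)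
  refine ⟨fun X => if hX : X.IsElliptic then s X hX else 1, ?_, ?_, ?_, ?_⟩
  · -- (1) `±1`-valued
    intro X
    dsimp only
    by_cases hX : X.IsElliptic
    · rw [dif_pos hX]; exact hs₁ X hX
    · rw [dif_neg hX]; exact Or.inl rfl
  · -- (2) invariance under changes of variables over `ℚ_v`
    intro X C
    dsimp only
    by_cases hX : X.IsElliptic
    · haveI := hX
      have hCX : (C • X).IsElliptic := inferInstance
      rw [dif_pos hCX, dif_pos hX]
      refine (huniq (D X • X) (D (C • X) • (C • X)) inferInstance (hD₁ X) (hD₂ X) (hD₃ X) (hD₄ X)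
        (hD₆ X) (D (C • X) * C * (D X)⁻¹) ?_ _ _ (hs₂ X hX) (hs₂ (C • X) hCX)).symm
      rw [mul_smul, mul_smul, inv_smul_smul]
    · rw [dif_neg (fun h => hX (hell X C h)), dif_neg hX]
  · -- (3) the value on a rational elliptic curve
    intro W hW
    haveI := hW
    have hWK : (W.baseChange (v.adicCompletion ℚ)).IsElliptic :=
      inferInstanceAs (W.map (algebraMap ℚ (v.adicCompletion ℚ))).IsElliptic
    dsimp only
    rw [dif_pos hWK]
    set X := W.baseChange (v.adicCompletion ℚ) with hXdef
    haveI := hWK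
    -- `a W` is an eventual value at the integral model `D X • X`
    obtain ⟨n, hn⟩ := hlc (D X • X) inferInstance (hD₁ X) (hD₂ X) (hD₃ X) (hD₄ X) (hD₆ X)
    have hEvW : Ev (D X • X) (a W) := by
      rw [hEv]
      refine ⟨n, fun W₁ hW₁ l₁ l₂ l₃ l₄ l₆ => ?_⟩
      obtain ⟨t, ht0, -, htn, -⟩ :=
        adicCompletion_exists_valued_le_and_le_exp_neg v (one_ne_zero (α := v.adicCompletion ℚ)) n
      obtain ⟨-, C', -, -, m₁, m₂, m₃, m₄, m₆⟩ :=
        adicCompletion_exists_rat_curve_variableChange_near v X (D X) ht0 ht0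
      have e : C'.map (algebraMap ℚ (v.adicCompletion ℚ)) • X =
          (C' • W).baseChange (v.adicCompletion ℚ) := map_variableChange W C' _
      rw [e] at m₁ m₂ m₃ m₄ m₆
      rw [hn W₁ (C' • W) hW₁ inferInstance l₁ l₂ l₃ l₄ l₆ (m₁.trans_le htn) (m₂.trans_le htn)
        (m₃.trans_le htn) (m₄.trans_le htn) (m₆.trans_le htn), hiso W C' hW]
    exact huniq (D X • X) (D X • X) inferInstance (hD₁ X) (hD₂ X) (hD₃ X) (hD₄ X) (hD₆ X) 1
      (one_smul _ _) _ _ (hs₂ X hWK) hEvW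
  · -- (4) local constancy at a `v`-integral elliptic `X`
    intro X hX i₁ i₂ i₃ i₄ i₆
    haveI := hX
    obtain ⟨n, hn⟩ := hlc X hX i₁ i₂ i₃ i₄ i₆
    refine ⟨n, fun Y hY j₁ j₂ j₃ j₄ j₆ k₁ k₂ k₃ k₄ k₆ => ?_⟩
    dsimp only
    rw [dif_pos hY, dif_pos hX]
    -- the eventual value `s'` at `X` itself is `s X hX`
    obtain ⟨s', -, hs'⟩ := hex X hX i₁ i₂ i₃ i₄ i₆
    have e' : s' = s X hX := huniq X (D X • X) hX i₁ i₂ i₃ i₄ i₆ (D X) rfl _ _ hs' (hs₂ X hX)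
    obtain ⟨m, hm⟩ := (hEv _ _).1 hs'
    -- a rational elliptic reference curve very close to `X`
    obtain ⟨Wb, hWb, b₁, b₂, b₃, b₄, b₆⟩ :=
      adicCompletion_exists_rat_isElliptic_near v X i₁ i₂ i₃ i₄ i₆ X.isUnit_Δ.ne_zero (max n m)
    have hmn : WithZero.exp (-((max n m : ℕ) : ℤ)) ≤ WithZero.exp (-(n : ℤ)) :=
      WithZero.exp_le_exp.2 (neg_le_neg (by exact_mod_cast le_max_left n m))
    have hmm : WithZero.exp (-((max n m : ℕ) : ℤ)) ≤ WithZero.exp (-(m : ℤ)) :=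
      WithZero.exp_le_exp.2 (neg_le_neg (by exact_mod_cast le_max_right n m))
    have hb : a Wb = s' := hm Wb hWb (b₁.trans_le hmm) (b₂.trans_le hmm) (b₃.trans_le hmm)
      (b₄.trans_le hmm) (b₆.trans_le hmm)
    -- `s X hX` is an eventual value at `Y` (ultrametric inequality)
    have hEvY : Ev Y (s X hX) := by
      rw [hEv]
      refine ⟨n, fun W hW l₁ l₂ l₃ l₄ l₆ => ?_⟩
      have c₁ : Valued.v ((W.baseChange (v.adicCompletion ℚ)).a₁ - X.a₁) < WithZero.exp (-(n : ℤ)) := by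
        have h := Valuation.map_add_lt _ l₁ k₁; rwa [sub_add_sub_cancel] at h
      have c₂ : Valued.v ((W.baseChange (v.adicCompletion ℚ)).a₂ - X.a₂) < WithZero.exp (-(n : ℤ)) := by
        have h := Valuation.map_add_lt _ l₂ k₂; rwa [sub_add_sub_cancel] at h
      have c₃ : Valued.v ((W.baseChange (v.adicCompletion ℚ)).a₃ - X.a₃) < WithZero.exp (-(n : ℤ)) := by
        have h := Valuation.map_add_lt _ l₃ k₃; rwa [sub_add_sub_cancel] at h
      have c₄ : Valued.v ((W.baseChange (v.adicCompletion ℚ)).a₄ - X.a₄) < WithZero.exp (-(n : ℤ)) := by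
        have h := Valuation.map_add_lt _ l₄ k₄; rwa [sub_add_sub_cancel] at h
      have c₆ : Valued.v ((W.baseChange (v.adicCompletion ℚ)).a₆ - X.a₆) < WithZero.exp (-(n : ℤ)) := by
        have h := Valuation.map_add_lt _ l₆ k₆; rwa [sub_add_sub_cancel] at h
      rw [← e', ← hb]
      exact hn W Wb hW hWb c₁ c₂ c₃ c₄ c₆ (b₁.trans_le hmn) (b₂.trans_le hmn) (b₃.trans_le hmn)
        (b₄.trans_le hmn) (b₆.trans_le hmn)
    exact (huniq Y (D Y • Y) hY j₁ j₂ j₃ j₄ j₆ (D Y) rfl _ _ hEvY (hs₂ Y hY)).symm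


/-- **Helfgott's locally constant local tables from the Modularity Theorem, Kellock–Dokchitser's
Remark 2.2 above `p ≥ 5`, and the `v`-adic local constancy of the Atkin–Lehner sign at `v ∣ 6`.**
The named fact `Helfgott2004_exists_local_tables_locallyConstant` (local tables of `±1`-valued local
root numbers at all finite places of `ℚ`, invariant under `ℚ_v`-isomorphism, equal to Rohrlich's
`localRootNumber` above `p ≥ 5`, computing the analytic global root number, and locally constant in
the coefficients — Helfgott 2004, Prop. 4.2, proof of Prop. 4.3, Lemma 4.4) follows from

* `hmod` — the Modularity Theorem `exists_isNewformOf` (BCDT 2001, Thm. A);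
* `hF1` — Kellock–Dokchitser 2023, Rem. 2.2 at the primes `p ≥ 5` against Rohrlich's list, the
  named fact `WeierstrassCurve.atkinLehnerEigenvalueAt_eq_localRootNumberAt`, for every `W`;
* `hlc` — for each place `v` of residue characteristic `≤ 3` and each elliptic equation `X` over
  `ℚ_v` with coefficients in `O_v`: there is `n` such that any two elliptic `W₁, W₂ / ℚ` whose
  coefficients are within `exp(−n)` of those of `X` in `ℚ_v` have the same Atkin–Lehner sign
  `[p ∣ N_W ? λ(Q_p)(f_W) : 1]` (`f_W` the newform of `W`). This is the **local constancy of
  `W(E/ℚ_p)` in the `p`-adic topology at `p = 2, 3`** — Helfgott 2004, Prop. 4.2 (potentially good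
  reduction: the `ℓ`-adic Tate modules of `v`-adically close curves are isomorphic Galois modules,
  and "`W(E)` is determined by the representation of the Weil group on `T_ℓ(E)`", i.e. Deligne's
  local constants) and the last paragraph of the proof of Prop. 4.3 (potentially multiplicative
  reduction, Rohrlich's formulae), as combined in Lemma 4.4 — read through Kellock–Dokchitser's
  Remark 2.2, `W(E/ℚ_p) = λ(Q_p)(f_E)` (local–global compatibility of the Langlands correspondence
  for `GL₂`). Neither the Deligne–Langlands local constant of an elliptic curve over `ℚ₂, ℚ₃` nor
  that compatibility is in the tree, so this is taken as the hypothesis; it is the genuinely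
  residual input: the rest of the deduction of the named fact is proved here and in
  `RootNumberLocalConstancyProofs` (Helfgott's own argument *at* `v ∣ 6` — Tate modules, local
  constants — is what the hypothesis stands for, not something proved in the tree).

Proof. Above `p ≥ 5` the tables are Rohrlich's `localRootNumber (O_v)` on elliptic curves (`1` on
singular ones): `±1`-valued, `ℚ_v`-invariant (`localRootNumber_sq_eq_one_holds`,
`localRootNumber_smul_holds`), interpolating the Atkin–Lehner eigenvalues
(`localRootNumberAt_eq_ite_of_atkinLehner`, from `hF1`) and locally constant
(`localRootNumber_adicCompletion_locallyConstant`, Helfgott's argument in residue characteristic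
`≥ 5`, file `RootNumberLocalConstancyProofs`). Above `2, 3` the integer-valued Atkin–Lehner sign
`a(W)` of an elliptic `W / ℚ` (`λ(Q_p) = ±1`, Knapp 1993, Thm. 9.27(b); the newform is unique) is
invariant under changes of variables over `ℚ` — `N_{C • W} = N_W` (`WeierstrassCurve.conductorNorm_smul`,
Tate's algorithm is well defined) and `L(C • W, s) = L(W, s)` (`WeierstrassCurve.LFunction_smul`), so
`C • W` and `W` have the same newform — and `v`-adically locally constant by `hlc`; by
`exists_table_of_locallyConstant` (density of `ℚ` in `ℚ_v`, continuity of the action of changes of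
variables, ultrametric inequality) it extends to a `ℚ_v`-invariant, locally constant, `±1`-valued
table on Weierstrass curves over `ℚ_v`. The product formula for the analytic root number is
`rootNumber_eq_neg_finprod_of_exists_isNewformOf` (Hecke's functional equation for the newform,
`ε(f) = ∏_{p ∣ N} λ(Q_p)`, uniqueness of the sign), and the reduction to the places above `2, 3` is
`Helfgott2004_exists_local_tables_locallyConstant_iff_two_three`. So the trust base of
`Helfgott2004_exists_local_tables_locallyConstant` in the tree is {Modularity (`exists_isNewformOf`),
Kellock–Dokchitser Rem. 2.2 above `p ≥ 5` (`WeierstrassCurve.atkinLehnerEigenvalueAt_eq_localRootNumberAt`),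
`p`-adic local constancy of `λ(Q_p)(f_E)` in `E ×_ℚ ℚ_p` at `p ∈ {2, 3}`} — compare
`exists_local_tables_two_three_of_residual` for the weaker `exists_local_tables_two_three`, whose
residual input (locality of `λ(Q_p)(f_E)` in the `ℚ_p`-isomorphism class at additive `p ∈ {2, 3}`)
is implied by `hlc` (a `ℚ_p`-isomorphism is approximated by rational ones).
[cite: Helfgott2004RootNumberFamilies, §4 Prop. 4.2, Prop. 4.3 (proof) and Lemma 4.4]
[cite: KellockDokchitser2023, Def. 2.1, Rem. 2.2, Thm. 2.3 (PDF pp. 7–8)]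
[cite: Knapp1993, Thm. 9.27] [cite: BCDTJAMS2001, Thm. A] -/
theorem Helfgott2004_exists_local_tables_locallyConstant_of_residual (hmod : exists_isNewformOf)
    (hF1 : ∀ W : WeierstrassCurve ℚ, W.atkinLehnerEigenvalueAt_eq_localRootNumberAt)
    (hlc : ∀ v : HeightOneSpectrum ℤ, ringChar (ℤ ⧸ v.asIdeal) ≤ 3 →
      ∀ X : WeierstrassCurve (v.adicCompletion ℚ), X.IsElliptic →
        X.a₁ ∈ v.adicCompletionIntegers ℚ → X.a₂ ∈ v.adicCompletionIntegers ℚ →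
        X.a₃ ∈ v.adicCompletionIntegers ℚ → X.a₄ ∈ v.adicCompletionIntegers ℚ →
        X.a₆ ∈ v.adicCompletionIntegers ℚ →
        ∃ n : ℕ, ∀ (W₁ W₂ : WeierstrassCurve ℚ) [W₁.IsElliptic] [W₂.IsElliptic]
          [NeZero (W₁.conductorNorm ℤ)] [NeZero (W₂.conductorNorm ℤ)]
          (f₁ : CuspForm (Gamma0 (W₁.conductorNorm ℤ)) 2)
          (f₂ : CuspForm (Gamma0 (W₂.conductorNorm ℤ)) 2), IsNewformOf W₁ f₁ → IsNewformOf W₂ f₂ →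
          Valued.v ((W₁.baseChange (v.adicCompletion ℚ)).a₁ - X.a₁) < WithZero.exp (-(n : ℤ)) →
          Valued.v ((W₁.baseChange (v.adicCompletion ℚ)).a₂ - X.a₂) < WithZero.exp (-(n : ℤ)) →
          Valued.v ((W₁.baseChange (v.adicCompletion ℚ)).a₃ - X.a₃) < WithZero.exp (-(n : ℤ)) →
          Valued.v ((W₁.baseChange (v.adicCompletion ℚ)).a₄ - X.a₄) < WithZero.exp (-(n : ℤ)) →
          Valued.v ((W₁.baseChange (v.adicCompletion ℚ)).a₆ - X.a₆) < WithZero.exp (-(n : ℤ)) →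
          Valued.v ((W₂.baseChange (v.adicCompletion ℚ)).a₁ - X.a₁) < WithZero.exp (-(n : ℤ)) →
          Valued.v ((W₂.baseChange (v.adicCompletion ℚ)).a₂ - X.a₂) < WithZero.exp (-(n : ℤ)) →
          Valued.v ((W₂.baseChange (v.adicCompletion ℚ)).a₃ - X.a₃) < WithZero.exp (-(n : ℤ)) →
          Valued.v ((W₂.baseChange (v.adicCompletion ℚ)).a₄ - X.a₄) < WithZero.exp (-(n : ℤ)) →
          Valued.v ((W₂.baseChange (v.adicCompletion ℚ)).a₆ - X.a₆) < WithZero.exp (-(n : ℤ)) →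
          (if natGenerator v ∣ W₁.conductorNorm ℤ then atkinLehnerEigenvalueAt f₁ (natGenerator v)
            else 1 : ℂ) =
          if natGenerator v ∣ W₂.conductorNorm ℤ then atkinLehnerEigenvalueAt f₂ (natGenerator v)
            else 1) :
    Helfgott2004_exists_local_tables_locallyConstant := by
  have hmodU : existsUnique_isNewformOf := existsUnique_isNewformOf_of_exists hmod
  -- Step 1: above `2, 3`, the integer Atkin–Lehner sign and the table extending it
  have htab : ∀ v : HeightOneSpectrum ℤ, ringChar (ℤ ⧸ v.asIdeal) ≤ 3 →
      ∃ wv : WeierstrassCurve (v.adicCompletion ℚ) → ℤ,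
        (∀ X, wv X = 1 ∨ wv X = -1) ∧
        (∀ X (C : VariableChange (v.adicCompletion ℚ)), wv (C • X) = wv X) ∧
        (∀ (W : WeierstrassCurve ℚ) [W.IsElliptic] [NeZero (W.conductorNorm ℤ)]
          (f : CuspForm (Gamma0 (W.conductorNorm ℤ)) 2), IsNewformOf W f →
          (wv (W.baseChange (v.adicCompletion ℚ)) : ℂ) =
            if natGenerator v ∣ W.conductorNorm ℤ then atkinLehnerEigenvalueAt f (natGenerator v)
            else 1) ∧
        ∀ X : WeierstrassCurve (v.adicCompletion ℚ), X.IsElliptic →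
          X.a₁ ∈ v.adicCompletionIntegers ℚ → X.a₂ ∈ v.adicCompletionIntegers ℚ →
          X.a₃ ∈ v.adicCompletionIntegers ℚ → X.a₄ ∈ v.adicCompletionIntegers ℚ →
          X.a₆ ∈ v.adicCompletionIntegers ℚ →
          ∃ n : ℕ, ∀ Y : WeierstrassCurve (v.adicCompletion ℚ), Y.IsElliptic →
            Y.a₁ ∈ v.adicCompletionIntegers ℚ → Y.a₂ ∈ v.adicCompletionIntegers ℚ →
            Y.a₃ ∈ v.adicCompletionIntegers ℚ → Y.a₄ ∈ v.adicCompletionIntegers ℚ →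
            Y.a₆ ∈ v.adicCompletionIntegers ℚ →
            Valued.v (Y.a₁ - X.a₁) < WithZero.exp (-(n : ℤ)) →
            Valued.v (Y.a₂ - X.a₂) < WithZero.exp (-(n : ℤ)) →
            Valued.v (Y.a₃ - X.a₃) < WithZero.exp (-(n : ℤ)) →
            Valued.v (Y.a₄ - X.a₄) < WithZero.exp (-(n : ℤ)) →
            Valued.v (Y.a₆ - X.a₆) < WithZero.exp (-(n : ℤ)) → wv Y = wv X := by
    intro v hv
    -- the sign `[p ∣ N ? λ(Q_p)(f) : 1]` is `±1`
    have hsign : ∀ (W : WeierstrassCurve ℚ) [W.IsElliptic] [NeZero (W.conductorNorm ℤ)]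
        (f : CuspForm (Gamma0 (W.conductorNorm ℤ)) 2), IsNewformOf W f →
        (if natGenerator v ∣ W.conductorNorm ℤ then atkinLehnerEigenvalueAt f (natGenerator v)
          else 1 : ℂ) = 1 ∨
        (if natGenerator v ∣ W.conductorNorm ℤ then atkinLehnerEigenvalueAt f (natGenerator v)
          else 1 : ℂ) = -1 := by
      intro W _ _ f hf
      by_cases hd : natGenerator v ∣ W.conductorNorm ℤ
      · rw [if_pos hd]
        exact hf.1.atkinLehnerEigenvalueAt_eq_one_or_eq_neg_one (prime_natGenerator v) hd
      · rw [if_neg hd]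
        exact Or.inl rfl
    -- an integer-valued version `a` of the sign (value `1` on singular curves)
    have key : ∀ W : WeierstrassCurve ℚ, ∃ z : ℤ, (z = 1 ∨ z = -1) ∧
        ∀ (_ : W.IsElliptic) (_ : NeZero (W.conductorNorm ℤ))
          (f : CuspForm (Gamma0 (W.conductorNorm ℤ)) 2), IsNewformOf W f →
          (z : ℂ) = if natGenerator v ∣ W.conductorNorm ℤ then
            atkinLehnerEigenvalueAt f (natGenerator v) else 1 := by
      intro W
      by_cases hW : W.IsElliptic
      · haveI : NeZero (W.conductorNorm ℤ) := ⟨(W.conductorNorm_pos_holds).ne'⟩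
        obtain ⟨f₀, hf₀⟩ := hmod W
        rcases hsign W f₀ hf₀ with h1 | h1
        · refine ⟨1, Or.inl rfl, fun _ _ f hf ↦ ?_⟩
          rw [(hmodU W).unique hf hf₀, h1, Int.cast_one]
        · refine ⟨-1, Or.inr rfl, fun _ _ f hf ↦ ?_⟩
          rw [(hmodU W).unique hf hf₀, h1, Int.cast_neg, Int.cast_one]
      · exact ⟨1, Or.inl rfl, fun h ↦ absurd h hW⟩
    choose a ha₁ ha₂ using key
    -- `a` is invariant under changes of variables over `ℚ`: `C • W` and `W` have the same
    -- conductor and the same `L`-function, hence the same newform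
    have hiso : ∀ (W : WeierstrassCurve ℚ) (C : VariableChange ℚ), W.IsElliptic →
        a (C • W) = a W := by
      intro W C hW
      haveI := hW
      haveI : NeZero (W.conductorNorm ℤ) := ⟨(W.conductorNorm_pos_holds).ne'⟩
      haveI : NeZero ((C • W).conductorNorm ℤ) := ⟨((C • W).conductorNorm_pos_holds).ne'⟩
      have hN : (C • W).conductorNorm ℤ = W.conductorNorm ℤ := conductorNorm_smul ℤ W C
      obtain ⟨f, hf⟩ := hmod W
      have transport : ∀ (N₁ N₂ : ℕ) [NeZero N₁] [NeZero N₂], N₁ = N₂ →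
          ∀ g : CuspForm (Gamma0 N₂) 2, IsNewformOf W g →
          ∃ g' : CuspForm (Gamma0 N₁) 2, IsNewformOf W g' ∧
            ∀ p, atkinLehnerEigenvalueAt g' p = atkinLehnerEigenvalueAt g p := by
        intro N₁ N₂ _ _ h
        subst h
        exact fun g hg => ⟨g, hg, fun _ => rfl⟩
      obtain ⟨f', hf', hAL⟩ := transport _ _ hN f hf
      have hf'' : IsNewformOf (C • W) f' :=
        ⟨hf'.1, fun n => by rw [LFunction_smul W C]; exact hf'.2 n⟩
      have e₁ := ha₂ (C • W) inferInstance inferInstance f' hf''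
      have e₂ := ha₂ W hW inferInstance f hf
      simp only [hAL] at e₁
      rw [hN] at e₁
      exact_mod_cast e₁.trans e₂.symm
    -- `a` is `v`-adically locally constant (hypothesis `hlc`)
    have hlc' : ∀ X : WeierstrassCurve (v.adicCompletion ℚ), X.IsElliptic →
        X.a₁ ∈ v.adicCompletionIntegers ℚ → X.a₂ ∈ v.adicCompletionIntegers ℚ →
        X.a₃ ∈ v.adicCompletionIntegers ℚ → X.a₄ ∈ v.adicCompletionIntegers ℚ →
        X.a₆ ∈ v.adicCompletionIntegers ℚ →
        ∃ n : ℕ, ∀ W₁ W₂ : WeierstrassCurve ℚ, W₁.IsElliptic → W₂.IsElliptic →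
          Valued.v ((W₁.baseChange (v.adicCompletion ℚ)).a₁ - X.a₁) < WithZero.exp (-(n : ℤ)) →
          Valued.v ((W₁.baseChange (v.adicCompletion ℚ)).a₂ - X.a₂) < WithZero.exp (-(n : ℤ)) →
          Valued.v ((W₁.baseChange (v.adicCompletion ℚ)).a₃ - X.a₃) < WithZero.exp (-(n : ℤ)) →
          Valued.v ((W₁.baseChange (v.adicCompletion ℚ)).a₄ - X.a₄) < WithZero.exp (-(n : ℤ)) →
          Valued.v ((W₁.baseChange (v.adicCompletion ℚ)).a₆ - X.a₆) < WithZero.exp (-(n : ℤ)) →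
          Valued.v ((W₂.baseChange (v.adicCompletion ℚ)).a₁ - X.a₁) < WithZero.exp (-(n : ℤ)) →
          Valued.v ((W₂.baseChange (v.adicCompletion ℚ)).a₂ - X.a₂) < WithZero.exp (-(n : ℤ)) →
          Valued.v ((W₂.baseChange (v.adicCompletion ℚ)).a₃ - X.a₃) < WithZero.exp (-(n : ℤ)) →
          Valued.v ((W₂.baseChange (v.adicCompletion ℚ)).a₄ - X.a₄) < WithZero.exp (-(n : ℤ)) →
          Valued.v ((W₂.baseChange (v.adicCompletion ℚ)).a₆ - X.a₆) < WithZero.exp (-(n : ℤ)) →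
          a W₁ = a W₂ := by
      intro X hX i₁ i₂ i₃ i₄ i₆
      obtain ⟨n, hn⟩ := hlc v hv X hX i₁ i₂ i₃ i₄ i₆
      refine ⟨n, fun W₁ W₂ hW₁ hW₂ k₁ k₂ k₃ k₄ k₆ l₁ l₂ l₃ l₄ l₆ => ?_⟩
      haveI := hW₁
      haveI := hW₂
      haveI : NeZero (W₁.conductorNorm ℤ) := ⟨(W₁.conductorNorm_pos_holds).ne'⟩
      haveI : NeZero (W₂.conductorNorm ℤ) := ⟨(W₂.conductorNorm_pos_holds).ne'⟩
      obtain ⟨f₁, hf₁⟩ := hmod W₁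
      obtain ⟨f₂, hf₂⟩ := hmod W₂
      have h := hn W₁ W₂ f₁ f₂ hf₁ hf₂ k₁ k₂ k₃ k₄ k₆ l₁ l₂ l₃ l₄ l₆
      rw [← ha₂ W₁ hW₁ inferInstance f₁ hf₁, ← ha₂ W₂ hW₂ inferInstance f₂ hf₂] at h
      exact_mod_cast h
    obtain ⟨wv, hw₁, hw₂, hw₃, hw₄⟩ :=
      exists_table_of_locallyConstant v a (fun W _ => ha₁ W) hiso hlc'
    refine ⟨wv, hw₁, hw₂, fun W _ _ f hf => ?_, hw₄⟩
    rw [hw₃ W inferInstance]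
    exact ha₂ W inferInstance inferInstance f hf
  -- Step 2: the tables at all places and the five clauses
  choose w₂₃ hw₁ hw₂ hw₃ hw₄ using htab
  rw [Helfgott2004_exists_local_tables_locallyConstant_iff_two_three]
  refine ⟨fun v X ↦ if hv : 3 < ringChar (ℤ ⧸ v.asIdeal) then
      (if X.IsElliptic then X.localRootNumber (v.adicCompletionIntegers ℚ) else 1)
    else w₂₃ v (not_lt.mp hv) X, ?_, ?_, ?_, ?_, ?_⟩
  · -- (1) the tables are `±1`-valued
    intro v X
    dsimp only
    by_cases hv : 3 < ringChar (ℤ ⧸ v.asIdeal)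
    · rw [dif_pos hv]
      by_cases hX : X.IsElliptic
      · rw [if_pos hX]
        exact localRootNumber_adicCompletion_eq_one_or hv X
      · rw [if_neg hX]
        exact Or.inl rfl
    · rw [dif_neg hv]
      exact hw₁ v (not_lt.mp hv) X
  · -- (2) invariance under changes of variables over `ℚ_v`
    intro v X C
    dsimp only
    by_cases hv : 3 < ringChar (ℤ ⧸ v.asIdeal)
    · rw [dif_pos hv, dif_pos hv]
      by_cases hX : X.IsElliptic
      · haveI := hX
        rw [if_pos (inferInstance : (C • X).IsElliptic), if_pos hX]
        exact X.localRootNumber_smul_holds (v.adicCompletionIntegers ℚ) C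
      · have hC : ¬ (C • X).IsElliptic := fun h ↦ hX (by
          haveI := h
          simpa using (inferInstance : (C⁻¹ • (C • X)).IsElliptic))
        rw [if_neg hC, if_neg hX]
    · rw [dif_neg hv, dif_neg hv]
      exact hw₂ v (not_lt.mp hv) X C
  · -- (3) agreement with Rohrlich's `localRootNumber` above `p ≥ 5`
    intro v X hX hv
    dsimp only
    rw [dif_pos hv, if_pos hX]
  · -- (4) the product formula for the analytic root number
    intro W hW
    haveI := hW
    haveI : NeZero (W.conductorNorm ℤ) := ⟨(W.conductorNorm_pos_holds).ne'⟩
    refine rootNumber_eq_neg_finprod_of_exists_isNewformOf hmod W _ fun f hf v ↦ ?_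
    dsimp only
    by_cases hv : 3 < ringChar (ℤ ⧸ v.asIdeal)
    · haveI : (W.baseChange (v.adicCompletion ℚ)).IsElliptic :=
        inferInstanceAs (W.map (algebraMap ℚ (v.adicCompletion ℚ))).IsElliptic
      rw [dif_pos hv, if_pos (inferInstance : (W.baseChange (v.adicCompletion ℚ)).IsElliptic)]
      exact localRootNumberAt_eq_ite_of_atkinLehner W (hF1 W) hf hv
    · rw [dif_neg hv]
      exact hw₃ v (not_lt.mp hv) W f hf
  · -- (5) local constancy above `2, 3`
    intro v hv X hX i₁ i₂ i₃ i₄ i₆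
    obtain ⟨n, hn⟩ := hw₄ v hv X hX i₁ i₂ i₃ i₄ i₆
    refine ⟨n, fun Y hY j₁ j₂ j₃ j₄ j₆ k₁ k₂ k₃ k₄ k₆ => ?_⟩
    dsimp only
    rw [dif_neg (not_lt.mpr hv), dif_neg (not_lt.mpr hv)]
    exact hn Y hY j₁ j₂ j₃ j₄ j₆ k₁ k₂ k₃ k₄ k₆


/-- **`exists_local_tables_two_three` from the Modularity Theorem, Kellock–Dokchitser's Remark 2.2
above `p ≥ 5`, and the `p`-adic local constancy of the Atkin–Lehner sign at `p = 2, 3`** (through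
`Helfgott2004_exists_local_tables_locallyConstant_of_residual` and
`exists_local_tables_two_three_of_locallyConstant`): the residual input `hres` of
`exists_local_tables_two_three_of_residual` (locality of `λ(Q_p)(f_E)` in the `ℚ_p`-isomorphism class
at additive `p ∈ {2, 3}`) is implied by local constancy, a `ℚ_p`-isomorphism being a limit of
rational ones. [cite: Helfgott2004RootNumberFamilies, §4 Lemma 4.4]
[cite: KellockDokchitser2023, Def. 2.1, Rem. 2.2 and Thm. 2.3] -/
theorem exists_local_tables_two_three_of_locallyConstant_residual (hmod : exists_isNewformOf)
    (hF1 : ∀ W : WeierstrassCurve ℚ, W.atkinLehnerEigenvalueAt_eq_localRootNumberAt)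
    (hlc : ∀ v : HeightOneSpectrum ℤ, ringChar (ℤ ⧸ v.asIdeal) ≤ 3 →
      ∀ X : WeierstrassCurve (v.adicCompletion ℚ), X.IsElliptic →
        X.a₁ ∈ v.adicCompletionIntegers ℚ → X.a₂ ∈ v.adicCompletionIntegers ℚ →
        X.a₃ ∈ v.adicCompletionIntegers ℚ → X.a₄ ∈ v.adicCompletionIntegers ℚ →
        X.a₆ ∈ v.adicCompletionIntegers ℚ →
        ∃ n : ℕ, ∀ (W₁ W₂ : WeierstrassCurve ℚ) [W₁.IsElliptic] [W₂.IsElliptic]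
          [NeZero (W₁.conductorNorm ℤ)] [NeZero (W₂.conductorNorm ℤ)]
          (f₁ : CuspForm (Gamma0 (W₁.conductorNorm ℤ)) 2)
          (f₂ : CuspForm (Gamma0 (W₂.conductorNorm ℤ)) 2), IsNewformOf W₁ f₁ → IsNewformOf W₂ f₂ →
          Valued.v ((W₁.baseChange (v.adicCompletion ℚ)).a₁ - X.a₁) < WithZero.exp (-(n : ℤ)) →
          Valued.v ((W₁.baseChange (v.adicCompletion ℚ)).a₂ - X.a₂) < WithZero.exp (-(n : ℤ)) →
          Valued.v ((W₁.baseChange (v.adicCompletion ℚ)).a₃ - X.a₃) < WithZero.exp (-(n : ℤ)) →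
          Valued.v ((W₁.baseChange (v.adicCompletion ℚ)).a₄ - X.a₄) < WithZero.exp (-(n : ℤ)) →
          Valued.v ((W₁.baseChange (v.adicCompletion ℚ)).a₆ - X.a₆) < WithZero.exp (-(n : ℤ)) →
          Valued.v ((W₂.baseChange (v.adicCompletion ℚ)).a₁ - X.a₁) < WithZero.exp (-(n : ℤ)) →
          Valued.v ((W₂.baseChange (v.adicCompletion ℚ)).a₂ - X.a₂) < WithZero.exp (-(n : ℤ)) →
          Valued.v ((W₂.baseChange (v.adicCompletion ℚ)).a₃ - X.a₃) < WithZero.exp (-(n : ℤ)) →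
          Valued.v ((W₂.baseChange (v.adicCompletion ℚ)).a₄ - X.a₄) < WithZero.exp (-(n : ℤ)) →
          Valued.v ((W₂.baseChange (v.adicCompletion ℚ)).a₆ - X.a₆) < WithZero.exp (-(n : ℤ)) →
          (if natGenerator v ∣ W₁.conductorNorm ℤ then atkinLehnerEigenvalueAt f₁ (natGenerator v)
            else 1 : ℂ) =
          if natGenerator v ∣ W₂.conductorNorm ℤ then atkinLehnerEigenvalueAt f₂ (natGenerator v)
            else 1) :
    exists_local_tables_two_three :=
  exists_local_tables_two_three_of_locallyConstant
    (Helfgott2004_exists_local_tables_locallyConstant_of_residual hmod hF1 hlc)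

end Literature.NumberTheory.EllipticCurves

end
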